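import Literature.Computability.QuantumComplexity.TermCodeFP
import Literature.Computability.Complexity.CodeFPBudgets
import HarnessLib
/-!
# The Bravyi–Gosset estimator on codes, IV: the sample loop and the output

Topic `Literature/Computability/QuantumComplexity`, sub-namespace `BravyiGosset`, machine side of
the discharge of `BravyiGosset2016_estimateAcceptProb` (continued from `TermCodeFP.lean`).
The estimator `estimate i r` (`BravyiGossetEstimator.lean`) runs through `L = 16(q+1)²` sample
blocks of the coin string and, per sample, through the `2^{⌈t/2⌉}` terms. Here this double loop
is flattened into the orbit of ONE step function on a small loop state
`(l, a, (E, O), (U, V))` — sample index, term number, current accumulators, totals —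
(`stepLS`, `iterLS_spec`, `estimate_eq_finalize_iterLS`), the step and the output `finalize` are
computed on codes (`stepLS_codeFP`, `finalize_codeFP`, `output_codeFP`), and the loop state code is bounded
polynomially in the machine input, uniformly along the orbit (`length_lsE_iterLS_le`). The
machine of the sequel runs one step per round.

## References

* S. Arora, B. Barak, *Computational Complexity: A Modern Approach*, CUP 2009, §1.3, §7.1.
* S. Bravyi, D. Gosset, *Improved classical simulation of quantum circuits dominated by Clifford
  gates*, Phys. Rev. Lett. 116 (2016) 250501, p. 2 and §II eq. (12)–(16).
-/

namespace Literature.Computability.QuantumComplexity.BravyiGosset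

open _root_.Computability Literature.Computability.Complexity Literature.Computability.Complexity.CodeFP
  Literature.Computability.Cryptography Literature.Algebra.EuclideanLattices Finset

/-! ### Parameters read off the instance tuple -/

/-- The number of wires `N = n + m`. [folklore] -/
def nWires (it : IT) : ℕ := it.2.1.length + it.1.2.1

/-- The `l`-th block of `κ = N² + 2N` coins. [folklore] -/
def blockOf (it : IT) (r : List Bool) (l : ℕ) : List Bool :=
  (r.drop (l * blockLen (nWires it))).take (blockLen (nWires it))

/-- The number of terms `2^{⌈t/2⌉}`. [cite: BravyiGosset2016, §II eq. (13)] -/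
def numTerms (it : IT) : ℕ := 2 ^ SymState.numA (finalT it)

/-- The denominator `L 2^h 4^{1+⌈t/2⌉}` from the tuple. [folklore] -/
def denomT (it : IT) : ℕ := numSamples it.2.2 * 2 ^ (finalT it).nv * 4 ^ (SymState.numA (finalT it) + 1)

/-- Reading a block: position `p` of block `l` is coin `lκ + p` (and `0` from `κ` on). [folklore] -/
theorem getD_blockOf (it : IT) (r : List Bool) (l p : ℕ) :
    (blockOf it r l).getD p false = (if p < blockLen (nWires it) then r.getD (l * blockLen (nWires it) + p) false else false) := by
  unfold blockOf
  split
  · rename_i hp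
    rw [List.getD_eq_getElem?_getD, List.getElem?_take, if_pos hp, List.getElem?_drop, ← List.getD_eq_getElem?_getD]
  · rename_i hp
    rw [List.getD_eq_default]
    exact (List.length_take_le _ _).trans (not_lt.1 hp)

/-- The block read as a function is `wbit` of the block tuple of `SamplingChebyshev.lean`. [folklore] -/
theorem getD_blockOf_eq_wbit (it : IT) (r : List Bool) {L l : ℕ} (hl : l < L) :
    (fun p => (blockOf it r l).getD p false) = wbit (blocksOf (blockLen (nWires it)) r L ⟨l, hl⟩) := by
  funext p
  rw [getD_blockOf]
  unfold wbit blocksOf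
  split <;> rfl

/-! ### The number of variables and of `T` forms of the final state -/

/-- `nv` after one placed gate. [folklore] -/
theorem nv_step_toSymGate {N : ℕ} (g : QGate cliffordT N) (σ : SymState) :
    (SymState.step (toSymGate g) σ).nv = σ.nv + (if QGateIsH g then 1 else 0) := by
  rcases g with ⟨op, e⟩ | ⟨k, e⟩
  · cases op <;> rfl
  · rfl

/-- `nv` counts the Hadamard gates. [folklore] -/
theorem nv_execGates {N : ℕ} (gs : List (QGate cliffordT N)) (σ : SymState) :
    (SymState.execGates gs σ).nv = σ.nv + hCount gs := by
  induction gs generalizing σ with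
  | nil => simp [SymState.execGates]
  | cons g gs ih =>
    show (SymState.exec ((g :: gs).map toSymGate) σ).nv = _
    rw [List.map_cons, SymState.exec_cons]
    have := ih (SymState.step (toSymGate g) σ)
    rw [SymState.execGates] at this
    rw [this, nv_step_toSymGate, hCount_cons]
    omega

/-- The number of `T` forms after one placed gate. [folklore] -/
theorem length_tforms_step_toSymGate {N : ℕ} (g : QGate cliffordT N) (σ : SymState) :
    (SymState.step (toSymGate g) σ).tforms.length = σ.tforms.length + (if g.isT then 1 else 0) := by
  rcases g with ⟨op, e⟩ | ⟨k, e⟩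
  · cases op
    · rfl
    · rfl
    · show (σ.tforms ++ [_]).length = σ.tforms.length + 1
      rw [List.length_append, List.length_singleton]
    · rfl
  · rfl

/-- The `T` forms count the `T` gates. [folklore] -/
theorem length_tforms_execGates {N : ℕ} (gs : List (QGate cliffordT N)) (σ : SymState) :
    (SymState.execGates gs σ).tforms.length = σ.tforms.length + gs.countP fun g => g.isT := by
  induction gs generalizing σ with
  | nil => simp [SymState.execGates]
  | cons g gs ih =>
    show (SymState.exec ((g :: gs).map toSymGate) σ).tforms.length = _
    rw [List.map_cons, SymState.exec_cons]
    have := ih (SymState.step (toSymGate g) σ)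
    rw [SymState.execGates] at this
    rw [this, length_tforms_step_toSymGate, List.countP_cons]
    omega

/-- `⌈t/2⌉` of the final state is `(tCount + 1)/2`. [cite: BravyiGosset2016, eq. (17)] -/
theorem numA_finalT (i : CliffordTInstance) : SymState.numA (finalT (instTuple i)) = (i.tCount + 1) / 2 := by
  rw [← execGates_eq_finalT, SymState.numA, length_tforms_execGates]
  simp [SymState.init, CliffordTInstance.tCount, QCircuit.tCount_eq_countP]

/-- The denominator of the estimator is `denomT`. [folklore] -/
theorem denom_eq_denomT (i : CliffordTInstance) : denom i = denomT (instTuple i) := by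
  unfold denom denomT finalState
  rw [execGates_eq_finalT, ← execGates_eq_finalT i, nv_execGates]
  simp [SymState.init, instTuple]

/-- The final state is shaped by `N` and the number of gates. [folklore] -/
theorem shaped_finalT (it : IT) : (finalT it).Shaped (nWires it) it.1.2.2.length := by
  have := (SymState.shaped_initT it).foldl it.1.2.2
  rwa [Nat.zero_add] at this

/-! ### The loop state and its step -/

/-- Loop states: sample index `l`, term number `a`, accumulators `(E, O)`, totals `(U, V)`. [folklore] -/
abbrev LS : Type := ℕ × ℕ × ((ℤ × ℤ) × (ℤ × ℤ)) × (ℤ × ℤ)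

/-- `u = N(E) + N(O)` on integer pairs. [folklore] -/
def uZ (EO : (ℤ × ℤ) × (ℤ × ℤ)) : ℤ := EO.1.1 ^ 2 + EO.1.2 ^ 2 + EO.2.1 ^ 2 + EO.2.2 ^ 2

/-- `v = Re(Ē O) − Im(Ē O)` on integer pairs. [folklore] -/
def vZ (EO : (ℤ × ℤ) × (ℤ × ℤ)) : ℤ := (EO.1.1 * EO.2.1 + EO.1.2 * EO.2.2) - (EO.1.1 * EO.2.2 - EO.1.2 * EO.2.1)

/-- `uZ` is `uOf`. [folklore] -/
theorem uZ_eq (EO : GaussianInt × GaussianInt) : uZ (zgOf EO.1, zgOf EO.2) = uOf EO := by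
  unfold uZ uOf zgOf
  rw [Zsqrtd.norm_def, Zsqrtd.norm_def]
  ring

/-- `vZ` is `vOf`. [folklore] -/
theorem vZ_eq (EO : GaussianInt × GaussianInt) : vZ (zgOf EO.1, zgOf EO.2) = vOf EO := by
  unfold vZ vOf zgOf
  simp only [Zsqrtd.re_mul, Zsqrtd.im_mul, Zsqrtd.re_star, Zsqrtd.im_star]
  ring

/-- **One step of the loop**: one term of the current sample; after the last term of a sample,
bank `u, v` and move to the next sample. [cite: BravyiGosset2016, §II eq. (12)–(15)] -/
def stepLS (c : IT × List Bool) (s : LS) : LS :=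
  let EO' := termStepS (nWires c.1) (fun p => (blockOf c.1 c.2 s.1).getD p false) (finalT c.1) s.2.2.1 s.2.1
  if s.2.1 + 1 < numTerms c.1 then (s.1, s.2.1 + 1, EO', s.2.2.2)
  else (s.1 + 1, 0, (((0 : ℤ), (0 : ℤ)), ((0 : ℤ), (0 : ℤ))), (s.2.2.2.1 + uZ EO', s.2.2.2.2 + vZ EO'))

/-- The initial loop state. [folklore] -/
def initLS : LS := (0, 0, (((0 : ℤ), (0 : ℤ)), ((0 : ℤ), (0 : ℤ))), ((0 : ℤ), (0 : ℤ)))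

/-- The loop state after `j` steps. [folklore] -/
def iterLS (c : IT × List Bool) (j : ℕ) : LS := (stepLS c)^[j] initLS

/-- The accumulators of sample `l` after `a` terms, on pairs. [folklore] -/
def partialZ (c : IT × List Bool) (l a : ℕ) : (ℤ × ℤ) × (ℤ × ℤ) :=
  (List.range a).foldl (termStepS (nWires c.1) (fun p => (blockOf c.1 c.2 l).getD p false) (finalT c.1))
    (((0 : ℤ), (0 : ℤ)), ((0 : ℤ), (0 : ℤ)))

/-- The totals after `l` complete samples. [folklore] -/
def totalsZ (c : IT × List Bool) (l : ℕ) : ℤ × ℤ :=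
  (∑ l' ∈ range l, uZ (partialZ c l' (numTerms c.1)), ∑ l' ∈ range l, vZ (partialZ c l' (numTerms c.1)))

/-- One more term. [folklore] -/
theorem partialZ_succ (c : IT × List Bool) (l a : ℕ) :
    partialZ c l (a + 1) = termStepS (nWires c.1) (fun p => (blockOf c.1 c.2 l).getD p false) (finalT c.1) (partialZ c l a) a := by
  unfold partialZ; rw [List.range_succ, List.foldl_append]; rfl

/-- **The orbit of the loop**: after `l · 2^{⌈t/2⌉} + a` steps (`a < 2^{⌈t/2⌉}`) the state is
`(l, a, partial accumulators, totals of the first l samples)`. [folklore] -/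
theorem iterLS_spec (c : IT × List Bool) (l a : ℕ) (ha : a < numTerms c.1) :
    iterLS c (l * numTerms c.1 + a) = (l, a, partialZ c l a, totalsZ c l) := by
  induction l generalizing a with
  | zero =>
    induction a with
    | zero => simp [iterLS, initLS, partialZ, totalsZ]
    | succ a ih =>
      have h := ih (by omega)
      rw [Nat.zero_mul, Nat.zero_add] at h ⊢
      rw [iterLS, Function.iterate_succ_apply', ← iterLS, h, stepLS]
      simp only
      rw [if_pos ha, partialZ_succ]
  | succ l ihl =>
    induction a with
    | zero =>
      have hA : 0 < numTerms c.1 := Nat.one_le_two_pow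
      have h := ihl (numTerms c.1 - 1) (by omega)
      rw [Nat.add_zero, show (l + 1) * numTerms c.1 = l * numTerms c.1 + (numTerms c.1 - 1) + 1 by
        rw [Nat.succ_mul]; omega]
      rw [iterLS, Function.iterate_succ_apply', ← iterLS, h, stepLS]
      simp only
      rw [if_neg (by omega), ← partialZ_succ, show numTerms c.1 - 1 + 1 = numTerms c.1 by omega]
      have h0 : partialZ c (l + 1) 0 = (((0 : ℤ), (0 : ℤ)), ((0 : ℤ), (0 : ℤ))) := rfl
      have ht : totalsZ c (l + 1) = ((totalsZ c l).1 + uZ (partialZ c l (numTerms c.1)),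
          (totalsZ c l).2 + vZ (partialZ c l (numTerms c.1))) := by
        simp [totalsZ, Finset.sum_range_succ]
      rw [h0, ht]
    | succ a ih =>
      have h := ih (by omega)
      rw [show (l + 1) * numTerms c.1 + (a + 1) = (l + 1) * numTerms c.1 + a + 1 by omega]
      rw [iterLS, Function.iterate_succ_apply', ← iterLS, h, stepLS]
      simp only
      rw [if_pos ha, partialZ_succ]

/-- After all `L 2^{⌈t/2⌉}` steps: `(L, 0, 0, totals)`. [folklore] -/
theorem iterLS_final (c : IT × List Bool) (L : ℕ) :
    iterLS c (L * numTerms c.1) = (L, 0, (((0 : ℤ), (0 : ℤ)), ((0 : ℤ), (0 : ℤ))), totalsZ c L) := by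
  have := iterLS_spec c L 0 Nat.one_le_two_pow
  rw [Nat.add_zero] at this
  rw [this]; rfl

/-- The sample index after `j ≤ L 2^{⌈t/2⌉}` steps is `⌊j / 2^{⌈t/2⌉}⌋`. [folklore] -/
theorem iterLS_fst (c : IT × List Bool) (j : ℕ) : (iterLS c j).1 = j / numTerms c.1 := by
  have hA : 0 < numTerms c.1 := Nat.one_le_two_pow
  have := iterLS_spec c (j / numTerms c.1) (j % numTerms c.1) (Nat.mod_lt _ hA)
  rw [Nat.div_add_mod'] at this
  rw [this]

/-! ### The loop computes the estimator -/

/-- **The accumulators on pairs are those of `sampleEO`.** [cite: BravyiGosset2016, §II eq. (12)–(13)] -/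
theorem partialZ_numTerms (c : IT × List Bool) (l : ℕ) :
    partialZ c l (numTerms c.1) =
      (zgOf (sampleEO (nWires c.1) (finalT c.1).nv (fun p => (blockOf c.1 c.2 l).getD p false) (finalT c.1)).1,
       zgOf (sampleEO (nWires c.1) (finalT c.1).nv (fun p => (blockOf c.1 c.2 l).getD p false) (finalT c.1)).2) := by
  unfold partialZ sampleEO numTerms
  set β : ℕ → Bool := fun p => (blockOf c.1 c.2 l).getD p false
  have hσ := shaped_finalT c.1
  suffices key : ∀ (as : List ℕ) (EO : GaussianInt × GaussianInt),
      as.foldl (termStepS (nWires c.1) β (finalT c.1)) (zgOf EO.1, zgOf EO.2) =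
        (zgOf (as.foldl (termStep (nWires c.1) (finalT c.1).nv β (finalT c.1)) EO).1,
         zgOf (as.foldl (termStep (nWires c.1) (finalT c.1).nv β (finalT c.1)) EO).2) by
    have := key (List.range (2 ^ SymState.numA (finalT c.1))) (0, 0)
    simpa [zgOf] using this
  intro as
  induction as with
  | nil => intro EO; rfl
  | cons a as ih =>
    intro EO
    rw [List.foldl_cons, List.foldl_cons, termStepS_eq hσ, ih]

/-- **The loop computes the estimate**: `estimate i r` is `finalize` of the totals after
`L 2^{⌈t/2⌉}` steps, the denominator `denomT` and `q`. [cite: BravyiGosset2016, p. 2 and §II] -/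
theorem estimate_eq_finalize_iterLS (i : CliffordTInstance) (r : List Bool) :
    estimate i r = finalize (iterLS (instTuple i, r) (numSamples i.q * numTerms (instTuple i))).2.2.2.1
      (iterLS (instTuple i, r) (numSamples i.q * numTerms (instTuple i))).2.2.2.2 (denomT (instTuple i)) i.q := by
  rw [iterLS_final]
  unfold estimate estimateBlocks
  rw [denom_eq_denomT]
  have hN : nWires (instTuple i) = i.n + i.m := by simp [nWires, instTuple]
  have hσ : finalState i = finalT (instTuple i) := execGates_eq_finalT i
  have hu : ∀ l : Fin (numSamples i.q),
      uOf (sampleEO (i.n + i.m) (finalState i).nv (wbit (blocksOf (blockLen (i.n + i.m)) r (numSamples i.q) l)) (finalState i)) =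
        uZ (partialZ (instTuple i, r) l (numTerms (instTuple i))) := by
    intro l
    rw [partialZ_numTerms, uZ_eq]
    simp only
    rw [getD_blockOf_eq_wbit (instTuple i) r l.2, hN, hσ]
  have hv : ∀ l : Fin (numSamples i.q),
      vOf (sampleEO (i.n + i.m) (finalState i).nv (wbit (blocksOf (blockLen (i.n + i.m)) r (numSamples i.q) l)) (finalState i)) =
        vZ (partialZ (instTuple i, r) l (numTerms (instTuple i))) := by
    intro l
    rw [partialZ_numTerms, vZ_eq]
    simp only
    rw [getD_blockOf_eq_wbit (instTuple i) r l.2, hN, hσ]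
  have ht : totals i (blocksOf (blockLen (i.n + i.m)) r (numSamples i.q)) = totalsZ (instTuple i, r) (numSamples i.q) := by
    unfold totals totalsZ
    simp only
    rw [← Fin.sum_univ_eq_sum_range (fun l' => uZ (partialZ (instTuple i, r) l' (numTerms (instTuple i)))),
      ← Fin.sum_univ_eq_sum_range (fun l' => vZ (partialZ (instTuple i, r) l' (numTerms (instTuple i))))]
    simp only [Prod.mk.injEq]
    exact ⟨Finset.sum_congr rfl fun l _ => hu l, Finset.sum_congr rfl fun l _ => hv l⟩
  rw [ht]

/-! ### The step on codes -/

/-- The code of the loop context (the machine input): instance tuple and coins. [folklore] -/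
abbrev lcE : IT × List Bool → List Bool := pairE itE strE

/-- The code of a loop state. [folklore] -/
abbrev lsE : LS → List Bool := pairE natE (pairE natE (pairE eoE (pairE intE intE)))

/-- The machine input is the code of the loop context. [folklore] -/
theorem boolPair_encode_eq (i : CliffordTInstance) (r : List Bool) :
    boolPair (CliffordTInstance.encode i) r = lcE (instTuple i, r) := by
  rw [encode_eq_itE]; rfl

/-- `nWires` on codes (unary). [folklore] -/
theorem nWires_codeFP : CodeFP itE unE nWires := by
  exact ((unAdd.comp ((strLength.comp (snd _ _).fst').pair ((fst _ _).snd'.fst'))).congr fun _ => rfl :)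

/-- `blockLen` on codes (unary in, binary out). [folklore] -/
theorem blockLen_codeFP : CodeFP unE natE blockLen := by
  have hN : CodeFP unE natE (fun N => N) := natOfUn
  exact ((natAdd.comp ((natMul.comp (hN.pair hN)).pair (natMul.comp ((const _ 2).pair hN)))).congr fun _ => rfl :)

/-- Cutting with counts cut at the length. [folklore] -/
theorem take_drop_min (r : List Bool) (d k : ℕ) :
    ((r.drop (min d r.length)).take (min k r.length)) = (r.drop d).take k := by
  by_cases hd : d ≤ r.length
  · rw [min_eq_left hd]
    by_cases hk : k ≤ r.length
    · rw [min_eq_left hk]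
    · push Not at hk
      rw [min_eq_right hk.le, List.take_of_length_le (by simp), List.take_of_length_le (by simp; omega)]
  · push Not at hd
    rw [min_eq_right hd.le, List.drop_length, List.drop_eq_nil_of_le hd.le]
    simp

/-- The `l`-th block on codes: `((it, r), l) ↦ blockOf it r l` as a raw bit list. [folklore] -/
theorem blockOf_codeFP : CodeFP (pairE lcE natE) bitsE (fun t => blockOf t.1.1 t.1.2 t.2) := by
  have hr : CodeFP (pairE lcE natE) strE (fun t => t.1.2) := (fst _ _).snd'
  have hlen : CodeFP (pairE lcE natE) unE (fun t => t.1.2.length) := by exact (strLength.comp hr :)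
  have hκ : CodeFP (pairE lcE natE) natE (fun t => blockLen (nWires t.1.1)) := by
    exact (blockLen_codeFP.comp (nWires_codeFP.comp (fst _ _).fst') :)
  have hd : CodeFP (pairE lcE natE) unE (fun t => min (t.2 * blockLen (nWires t.1.1)) t.1.2.length) := by
    exact (unOfNatMin.comp (hlen.pair (natMul.comp ((snd _ _).pair hκ))) :)
  have hk : CodeFP (pairE lcE natE) unE (fun t => min (blockLen (nWires t.1.1)) t.1.2.length) := by
    exact (unOfNatMin.comp (hlen.pair hκ) :)
  have hs : CodeFP (pairE lcE natE) strE (fun t =>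
      (t.1.2.drop (min (t.2 * blockLen (nWires t.1.1)) t.1.2.length)).take (min (blockLen (nWires t.1.1)) t.1.2.length)) := by
    exact (strTake.comp (hk.pair (strDrop.comp (hd.pair hr))) :)
  refine ((bitsOfStr.comp hs).congr fun t => ?_)
  show ((t.1.2.drop (min (t.2 * blockLen (nWires t.1.1)) t.1.2.length)).take (min (blockLen (nWires t.1.1)) t.1.2.length)) = _
  rw [take_drop_min]; rfl

/-- `numTerms` on codes. [folklore] -/
theorem numTerms_codeFP : CodeFP itE natE numTerms := by
  exact ((natPow.comp ((const _ 2).pair (numA_codeFP.comp finalT_codeFP))).congr fun _ => rfl :)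

/-- `uZ` on codes. [folklore] -/
theorem uZ_codeFP : CodeFP eoE intE uZ := by
  have h1 : CodeFP eoE intE (fun t => t.1.1) := (fst _ _).fst'
  have h2 : CodeFP eoE intE (fun t => t.1.2) := (fst _ _).snd'
  have h3 : CodeFP eoE intE (fun t => t.2.1) := (snd _ _).fst'
  have h4 : CodeFP eoE intE (fun t => t.2.2) := (snd _ _).snd'
  have hsq : ∀ {g : (ℤ × ℤ) × (ℤ × ℤ) → ℤ}, CodeFP eoE intE g → CodeFP eoE intE (fun t => g t ^ 2) := fun hg =>
    (intMul.comp (hg.pair hg)).congr fun t => by rw [pow_two]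
  exact ((intAdd.comp ((intAdd.comp ((intAdd.comp ((hsq h1).pair (hsq h2))).pair (hsq h3))).pair (hsq h4))).congr
    fun _ => rfl :)

/-- `vZ` on codes. [folklore] -/
theorem vZ_codeFP : CodeFP eoE intE vZ := by
  have h1 : CodeFP eoE intE (fun t => t.1.1) := (fst _ _).fst'
  have h2 : CodeFP eoE intE (fun t => t.1.2) := (fst _ _).snd'
  have h3 : CodeFP eoE intE (fun t => t.2.1) := (snd _ _).fst'
  have h4 : CodeFP eoE intE (fun t => t.2.2) := (snd _ _).snd'
  have ha : CodeFP eoE intE (fun t => t.1.1 * t.2.1 + t.1.2 * t.2.2) := by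
    exact (intAdd.comp ((intMul.comp (h1.pair h3)).pair (intMul.comp (h2.pair h4))) :)
  have hb : CodeFP eoE intE (fun t => t.1.1 * t.2.2 - t.1.2 * t.2.1) := by
    exact (intSub.comp ((intMul.comp (h1.pair h4)).pair (intMul.comp (h2.pair h3))) :)
  exact ((intSub.comp (ha.pair hb)).congr fun _ => rfl :)

/-- **The loop step on codes**: `((it, r), s) ↦ stepLS (it, r) s`. [cite: AroraBarakCC2009, §1.3] -/
theorem stepLS_codeFP : CodeFP (pairE lcE lsE) lsE (fun t => stepLS t.1 t.2) := by
  have hc : CodeFP (pairE lcE lsE) lcE (fun t => t.1) := fst _ _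
  have hit : CodeFP (pairE lcE lsE) itE (fun t => t.1.1) := (fst _ _).fst'
  have hl : CodeFP (pairE lcE lsE) natE (fun t => t.2.1) := (snd _ _).fst'
  have ha : CodeFP (pairE lcE lsE) natE (fun t => t.2.2.1) := (snd _ _).snd'.fst'
  have hEO : CodeFP (pairE lcE lsE) eoE (fun t => t.2.2.2.1) := (snd _ _).snd'.snd'.fst'
  have hU : CodeFP (pairE lcE lsE) intE (fun t => t.2.2.2.2.1) := (snd _ _).snd'.snd'.snd'.fst'
  have hV : CodeFP (pairE lcE lsE) intE (fun t => t.2.2.2.2.2) := (snd _ _).snd'.snd'.snd'.snd'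
  have hσ : CodeFP (pairE lcE lsE) stE (fun t => finalT t.1.1) := by exact (finalT_codeFP.comp hit :)
  have hN : CodeFP (pairE lcE lsE) unE (fun t => nWires t.1.1) := by exact (nWires_codeFP.comp hit :)
  have hbl : CodeFP (pairE lcE lsE) bitsE (fun t => blockOf t.1.1 t.1.2 t.2.1) := by exact (blockOf_codeFP.comp (hc.pair hl) :)
  have hEO' : CodeFP (pairE lcE lsE) eoE (fun t =>
      termStepS (nWires t.1.1) (fun p => (blockOf t.1.1 t.1.2 t.2.1).getD p false) (finalT t.1.1) t.2.2.2.1 t.2.2.1) := by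
    exact (termStepS_codeFP.comp ((hσ.pair (hN.pair hbl)).pair (hEO.pair ha)) :)
  have hA : CodeFP (pairE lcE lsE) natE (fun t => numTerms t.1.1) := by exact (numTerms_codeFP.comp hit :)
  have ha1 : CodeFP (pairE lcE lsE) natE (fun t => t.2.2.1 + 1) := by exact (natAdd.comp (ha.pair (const _ 1)) :)
  have hlt : CodeFP (pairE lcE lsE) bitE (fun t => decide (t.2.2.1 + 1 < numTerms t.1.1)) := by
    exact (natLt.comp (ha1.pair hA) :)
  have hcont : CodeFP (pairE lcE lsE) lsE (fun t => (t.2.1, t.2.2.1 + 1,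
      termStepS (nWires t.1.1) (fun p => (blockOf t.1.1 t.1.2 t.2.1).getD p false) (finalT t.1.1) t.2.2.2.1 t.2.2.1, t.2.2.2.2)) := by
    exact (hl.pair (ha1.pair (hEO'.pair ((snd _ _).snd'.snd'.snd'))) :)
  have hU' : CodeFP (pairE lcE lsE) intE (fun t => t.2.2.2.2.1 +
      uZ (termStepS (nWires t.1.1) (fun p => (blockOf t.1.1 t.1.2 t.2.1).getD p false) (finalT t.1.1) t.2.2.2.1 t.2.2.1)) := by
    exact (intAdd.comp (hU.pair (uZ_codeFP.comp hEO')) :)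
  have hV' : CodeFP (pairE lcE lsE) intE (fun t => t.2.2.2.2.2 +
      vZ (termStepS (nWires t.1.1) (fun p => (blockOf t.1.1 t.1.2 t.2.1).getD p false) (finalT t.1.1) t.2.2.2.1 t.2.2.1)) := by
    exact (intAdd.comp (hV.pair (vZ_codeFP.comp hEO')) :)
  have hbank : CodeFP (pairE lcE lsE) lsE (fun t => (t.2.1 + 1, 0, (((0 : ℤ), (0 : ℤ)), ((0 : ℤ), (0 : ℤ))),
      (t.2.2.2.2.1 + uZ (termStepS (nWires t.1.1) (fun p => (blockOf t.1.1 t.1.2 t.2.1).getD p false) (finalT t.1.1) t.2.2.2.1 t.2.2.1),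
       t.2.2.2.2.2 + vZ (termStepS (nWires t.1.1) (fun p => (blockOf t.1.1 t.1.2 t.2.1).getD p false) (finalT t.1.1) t.2.2.2.1 t.2.2.1)))) := by
    exact ((natAdd.comp (hl.pair (const _ 1))).pair ((const _ (0 : ℕ)).pair ((const _ ((((0 : ℤ), (0 : ℤ)), ((0 : ℤ), (0 : ℤ))) :
      (ℤ × ℤ) × (ℤ × ℤ))).pair (hU'.pair hV'))) :)
  refine ((hlt.ite hcont hbank).congr fun t => ?_)
  unfold stepLS
  simp only [decide_eq_true_eq]

/-- The test `l < L`. [folklore] -/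
theorem ltL_codeFP : CodeFP (pairE lcE lsE) bitE (fun t => decide (t.2.1 < numSamples t.1.1.2.2)) := by
  have hq : CodeFP (pairE lcE lsE) natE (fun t => t.1.1.2.2 + 1) := by
    exact (natOfUn.comp (unSucc.comp ((fst _ _).fst'.snd'.snd')) :)
  have hL : CodeFP (pairE lcE lsE) natE (fun t => numSamples t.1.1.2.2) :=
    (natMul.comp ((const _ 16).pair (natMul.comp (hq.pair hq)))).congr fun t => by
      show 16 * ((t.1.1.2.2 + 1) * (t.1.1.2.2 + 1)) = numSamples t.1.1.2.2
      unfold numSamples; ring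
  exact (natLt.comp (((snd _ _).fst').pair hL) :)

/-! ### The output on codes -/

/-- The code of a rational: sign–magnitude numerator and binary denominator of the reduced
fraction (the layout of `encodeRat`). [cite: AroraBarakCC2009, §0.1] -/
def ratE : ℚ → List Bool := fun q => pairE smE natE (q.num, q.den)

/-- `encodeRat` is `ratE`. [folklore] -/
theorem encodeRat_eq_ratE (q : ℚ) : encodeRat q = ratE q := by
  show (encodingIntBool.pairBool encodingNatBool).encode (q.num, q.den) = _
  rw [pairE_eq]; rfl

/-- The reduced form of an odd numerator over a power of two. [folklore] -/
theorem num_den_odd_div_two_pow (c K : ℕ) :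
    ((2 * c + 1 : ℚ) / 2 ^ (K + 1)).num = (2 * c + 1 : ℕ) ∧ ((2 * c + 1 : ℚ) / 2 ^ (K + 1)).den = 2 ^ (K + 1) := by
  have hcop : Nat.Coprime (2 * c + 1) (2 ^ (K + 1)) :=
    Nat.Coprime.pow_right _ (Nat.coprime_comm.1 ((Nat.Prime.coprime_iff_not_dvd Nat.prime_two).2 (by omega)))
  have hq : ((2 * c + 1 : ℚ) / 2 ^ (K + 1)) = (((2 * c + 1 : ℕ) : ℤ) : ℚ) / (((2 ^ (K + 1) : ℕ) : ℤ) : ℚ) := by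
    push_cast; ring
  have hb : (0 : ℤ) < ((2 ^ (K + 1) : ℕ) : ℤ) := by positivity
  have hcop' : Nat.Coprime (((2 * c + 1 : ℕ) : ℤ)).natAbs (((2 ^ (K + 1) : ℕ) : ℤ)).natAbs := by
    rwa [Int.natAbs_natCast, Int.natAbs_natCast]
  refine ⟨?_, ?_⟩
  · rw [hq, Rat.num_div_eq_of_coprime hb hcop']
  · have := Rat.den_div_eq_of_coprime hb hcop'
    rw [← hq] at this
    exact_mod_cast this

/-- The inputs of `finalize`: `((U, V), (D, 1^q))`. [folklore] -/
abbrev finE : (ℤ × ℤ) × (ℕ × ℕ) → List Bool := pairE (pairE intE intE) (pairE natE unE)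

/-- `precK` on codes (unary). [folklore] -/
theorem precK_codeFP : CodeFP finE unE (fun t => precK t.1.1 t.1.2 t.2.1 t.2.2) := by
  -- the size of a numeral in unary (the same one-liner as `natSizeU_codeFP` of
  -- `HidingProgramMachine.lean`, which is not imported to keep the import closure small)
  have sizeUn_codeFP : CodeFP natE unE Nat.size :=
    (strLength.comp strOfNat).congr fun n => by show (natE n).length = Nat.size n; exact length_natE n
  have hU : CodeFP finE natE (fun t => t.1.1.natAbs) := by exact (intNatAbs.comp (fst _ _).fst' :)
  have hV : CodeFP finE natE (fun t => t.1.2.natAbs) := by exact (intNatAbs.comp (fst _ _).snd' :)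
  have h1 : CodeFP finE unE (fun t => Nat.size (t.1.1.natAbs + 2 * t.1.2.natAbs + 1)) := by
    exact (sizeUn_codeFP.comp (natAdd.comp ((natAdd.comp (hU.pair (natMul.comp ((const _ 2).pair hV)))).pair (const _ 1))) :)
  have h2 : CodeFP finE unE (fun t => Nat.size t.2.1) := by exact (sizeUn_codeFP.comp (snd _ _).fst' :)
  have h3 : CodeFP finE unE (fun t => t.2.2 + 5) := by
    exact ((unAdd.comp (((snd _ _).snd').pair (const _ (5 : ℕ)))).congr fun _ => rfl :)
  exact (unAdd.comp ((unAdd.comp (h1.pair h2)).pair h3)).congr fun t => by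
    show Nat.size (t.1.1.natAbs + 2 * t.1.2.natAbs + 1) + Nat.size t.2.1 + (t.2.2 + 5) = precK t.1.1 t.1.2 t.2.1 t.2.2
    unfold precK; ring

/-- `sqrtTerm V K` on codes: `(V, 1ᴷ) ↦ ±⌊√(2V²4ᴷ)⌋`. [folklore] -/
theorem sqrtTerm_codeFP : CodeFP (pairE intE unE) intE (fun t => sqrtTerm t.1 t.2) := by
  have hV : CodeFP (pairE intE unE) natE (fun t => t.1.natAbs) := by exact (intNatAbs.comp (fst _ _) :)
  have h4 : CodeFP (pairE intE unE) natE (fun t => 4 ^ t.2) := by exact (natPow.comp ((const _ 4).pair (snd _ _)) :)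
  have hm : CodeFP (pairE intE unE) natE (fun t => 2 * t.1.natAbs ^ 2 * 4 ^ t.2) :=
    (natMul.comp ((natMul.comp ((const _ 2).pair (natMul.comp (hV.pair hV)))).pair h4)).congr fun t => by
      show 2 * (t.1.natAbs * t.1.natAbs) * 4 ^ t.2 = 2 * t.1.natAbs ^ 2 * 4 ^ t.2
      rw [pow_two]
  have hs : CodeFP (pairE intE unE) intE (fun t => ((Nat.sqrt (2 * t.1.natAbs ^ 2 * 4 ^ t.2) : ℕ) : ℤ)) := by
    exact (intOfNat.comp (natSqrt.comp hm) :)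
  have hneg : CodeFP (pairE intE unE) intE (fun t => -((Nat.sqrt (2 * t.1.natAbs ^ 2 * 4 ^ t.2) : ℕ) : ℤ)) := by
    exact (intNeg.comp hs :)
  have hsgn : CodeFP (pairE intE unE) bitE (fun t => decide ((0 : ℤ) ≤ t.1)) := by
    exact (intLe.comp ((const _ (0 : ℤ)).pair (fst _ _)) :)
  refine ((hsgn.ite hs hneg).congr fun t => ?_)
  unfold sqrtTerm
  simp only [decide_eq_true_eq]

/-- The numerator–denominator pair written by `finalize`: `(0, 1)` or `(2c + 1, 2^{K+1})`. [folklore] -/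
def finalizeND (U V : ℤ) (D q : ℕ) : ℤ × ℕ :=
  if U = 0 ∧ V = 0 then (0, 1) else
    (((2 * ((U * 2 ^ precK U V D q + sqrtTerm V (precK U V D q)).toNat / D) + 1 : ℕ) : ℤ), 2 ^ (precK U V D q + 1))

/-- `ratE (finalize …)` is the code of `finalizeND`. [folklore] -/
theorem ratE_finalize (U V : ℤ) (D q : ℕ) : ratE (finalize U V D q) = pairE smE natE (finalizeND U V D q) := by
  unfold finalize finalizeND ratE
  by_cases h : U = 0 ∧ V = 0
  · rw [if_pos h, if_pos h]; rfl
  · rw [if_neg h, if_neg h]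
    simp only
    set c : ℕ := (U * 2 ^ precK U V D q + sqrtTerm V (precK U V D q)).toNat / D
    obtain ⟨hn, hd⟩ := num_den_odd_div_two_pow c (precK U V D q)
    have hc : ((2 * c + 1 : ℕ) : ℚ) = 2 * (c : ℚ) + 1 := by push_cast; ring
    rw [← hc] at hn hd ⊢
    · show boolPair (smE _) (natE _) = boolPair (smE _) (natE _)
      push_cast at hn hd ⊢
      rw [hn, hd]

/-- **`finalize` on codes**, with the output in the rational code. [cite: BravyiGosset2016, p. 2] -/
theorem finalize_codeFP : CodeFP finE ratE (fun t => finalize t.1.1 t.1.2 t.2.1 t.2.2) := by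
  have hU : CodeFP finE intE (fun t => t.1.1) := (fst _ _).fst'
  have hV : CodeFP finE intE (fun t => t.1.2) := (fst _ _).snd'
  have hD : CodeFP finE natE (fun t => t.2.1) := (snd _ _).fst'
  have hK : CodeFP finE unE (fun t => precK t.1.1 t.1.2 t.2.1 t.2.2) := precK_codeFP
  have h2K : CodeFP finE intE (fun t => ((2 ^ precK t.1.1 t.1.2 t.2.1 t.2.2 : ℕ) : ℤ)) := by
    exact (intOfNat.comp (natPow.comp ((const _ 2).pair hK)) :)
  have hs : CodeFP finE intE (fun t => sqrtTerm t.1.2 (precK t.1.1 t.1.2 t.2.1 t.2.2)) := by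
    exact (sqrtTerm_codeFP.comp (hV.pair hK) :)
  have hc : CodeFP finE natE (fun t =>
      (t.1.1 * 2 ^ precK t.1.1 t.1.2 t.2.1 t.2.2 + sqrtTerm t.1.2 (precK t.1.1 t.1.2 t.2.1 t.2.2)).toNat / t.2.1) := by
    exact ((natDiv.comp ((intToNat.comp (intAdd.comp ((intMul.comp (hU.pair h2K)).pair hs))).pair hD)).congr
      fun t => by push_cast; rfl :)
  have hnum : CodeFP finE intE (fun t =>
      ((2 * ((t.1.1 * 2 ^ precK t.1.1 t.1.2 t.2.1 t.2.2 + sqrtTerm t.1.2 (precK t.1.1 t.1.2 t.2.1 t.2.2)).toNat / t.2.1) + 1 : ℕ) : ℤ)) := by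
    exact (intOfNat.comp (natAdd.comp ((natMul.comp ((const _ 2).pair hc)).pair (const _ 1))) :)
  have hden : CodeFP finE natE (fun t => 2 ^ (precK t.1.1 t.1.2 t.2.1 t.2.2 + 1)) := by
    exact (natPow.comp ((const _ 2).pair (unSucc.comp hK)) :)
  have hz : CodeFP finE bitE (fun t => decide (t.1.1 = 0) && decide (t.1.2 = 0)) :=
    (intEq.comp (hU.pair (const _ (0 : ℤ)))).and (intEq.comp (hV.pair (const _ (0 : ℤ))))
  have hnd : CodeFP finE (pairE intE natE) (fun t => finalizeND t.1.1 t.1.2 t.2.1 t.2.2) := by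
    refine ((hz.ite (const _ (((0 : ℤ), (1 : ℕ)) : ℤ × ℕ)) (hnum.pair hden)).congr fun t => ?_)
    unfold finalizeND
    by_cases h : t.1.1 = 0 ∧ t.1.2 = 0
    · rw [if_pos h]; simp [h.1, h.2]
    · rw [if_neg h]
      have : (decide (t.1.1 = 0) && decide (t.1.2 = 0)) = false := by
        rw [Bool.and_eq_false_iff]; simp only [decide_eq_false_iff_not]; tauto
      rw [this]; rfl
  have hsm : CodeFP finE (pairE smE natE) (fun t => finalizeND t.1.1 t.1.2 t.2.1 t.2.2) := by
    exact (((smOfInt.comp hnd.fst').pair hnd.snd').congr fun _ => rfl :)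
  exact hsm.recodeOut fun t => (ratE_finalize _ _ _ _).symm

/-- `denomT` on codes. [folklore] -/
theorem denomT_codeFP : CodeFP itE natE denomT := by
  have hσ : CodeFP itE stE finalT := finalT_codeFP
  have hq : CodeFP itE natE (fun it => it.2.2 + 1) := by exact (natOfUn.comp (unSucc.comp (snd _ _).snd') :)
  have hL : CodeFP itE natE (fun it => numSamples it.2.2) :=
    (natMul.comp ((const _ 16).pair (natMul.comp (hq.pair hq)))).congr fun t => by
      show 16 * ((t.2.2 + 1) * (t.2.2 + 1)) = numSamples t.2.2
      unfold numSamples; ring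
  have h2 : CodeFP itE natE (fun it => 2 ^ (finalT it).nv) := by exact (natPow.comp ((const _ 2).pair (stNv.comp hσ)) :)
  have h4 : CodeFP itE natE (fun it => 4 ^ (SymState.numA (finalT it) + 1)) := by
    exact (natPow.comp ((const _ 4).pair (unSucc.comp (numA_codeFP.comp hσ))) :)
  exact ((natMul.comp ((natMul.comp (hL.pair h2)).pair h4)).congr fun _ => rfl :)

/-- **The output on codes**: `((it, r), s) ↦ ratE (finalize U V (denomT it) q)`. [cite: BravyiGosset2016, p. 2] -/
theorem output_codeFP : CodeFP (pairE lcE lsE) ratE (fun t => finalize t.2.2.2.2.1 t.2.2.2.2.2 (denomT t.1.1) t.1.1.2.2) := by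
  have hUV : CodeFP (pairE lcE lsE) (pairE intE intE) (fun t => t.2.2.2.2) := (snd _ _).snd'.snd'.snd'
  have hD : CodeFP (pairE lcE lsE) natE (fun t => denomT t.1.1) := by exact (denomT_codeFP.comp (fst _ _).fst' :)
  have hq : CodeFP (pairE lcE lsE) unE (fun t => t.1.1.2.2) := (fst _ _).fst'.snd'.snd'
  exact ((finalize_codeFP.comp (hUV.pair (hD.pair hq))).congr fun _ => rfl :)

/-! ### Magnitudes along the loop -/

/-- Multiplying by a power of `i` permutes and negates the coordinates. [folklore] -/
theorem natAbs_zgMul_iPowZg_le (e : ℕ) (z : ℤ × ℤ) :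
    (zgMul (iPowZg e) z).1.natAbs ≤ max z.1.natAbs z.2.natAbs ∧ (zgMul (iPowZg e) z).2.natAbs ≤ max z.1.natAbs z.2.natAbs := by
  unfold iPowZg zgMul
  split
  · simp
  · split
    · simp [Int.natAbs_neg]
    · split
      · simp [Int.natAbs_neg]
      · simp [Int.natAbs_neg]

/-- `zgMul` is commutative. [folklore] -/
theorem zgMul_comm (x y : ℤ × ℤ) : zgMul x y = zgMul y x := by
  unfold zgMul; ext <;> simp only <;> ring

/-- **The evaluator output is at most `2ᴷ` in each coordinate.** [folklore] -/
theorem natAbs_gaussEval_le (K : ℕ) (D : GData) :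
    (zgOf (GData.gaussEval K (GData.sanitize K D))).1.natAbs ≤ 2 ^ K ∧
      (zgOf (GData.gaussEval K (GData.sanitize K D))).2.natAbs ≤ 2 ^ K := by
  obtain ⟨_, h2⟩ := gStep_iterate K (GData.sanitize K D) ((1 : ℤ), (0 : ℤ))
  obtain ⟨_, _, b3, b4⟩ := gStep_iterate_sized (K := K) K (K, GData.sanitize K D, ((1 : ℤ), (0 : ℤ))) le_rfl
    (GData.sized_sanitize K D)
  simp only [Int.natAbs_one, Int.natAbs_zero, max_eq_left (Nat.zero_le 1), mul_one] at b3 b4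
  have h1 : zgMul ((1 : ℤ), (0 : ℤ)) (zgOf (GData.gaussEval K (GData.sanitize K D))) = zgOf (GData.gaussEval K (GData.sanitize K D)) := by
    unfold zgMul; simp
  rw [h1] at h2
  rw [← h2, zgMul_comm]
  have := natAbs_zgMul_iPowZg_le (gStep^[K] (K, GData.sanitize K D, ((1 : ℤ), (0 : ℤ)))).2.1.mu
    (gStep^[K] (K, GData.sanitize K D, ((1 : ℤ), (0 : ℤ)))).2.2
  exact ⟨this.1.trans (max_le b3 b4), this.2.trans (max_le b3 b4)⟩

/-- The coordinate bound of a pair of accumulators. [folklore] -/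
def EOBound (EO : (ℤ × ℤ) × (ℤ × ℤ)) (M : ℕ) : Prop :=
  EO.1.1.natAbs ≤ M ∧ EO.1.2.natAbs ≤ M ∧ EO.2.1.natAbs ≤ M ∧ EO.2.2.natAbs ≤ M

/-- **One term step grows the accumulators by at most `2ᴷ`**, `K = numV`. [folklore] -/
theorem eoBound_termStepS (N : ℕ) (β : ℕ → Bool) (σ : SymState) {EO : (ℤ × ℤ) × (ℤ × ℤ)} {M : ℕ} (h : EOBound EO M) (A : ℕ) :
    EOBound (termStepS N β σ EO A) (M + 2 ^ SymState.numV σ.nv σ) := by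
  obtain ⟨h1, h2, h3, h4⟩ := h
  unfold termStepS
  simp only
  set K := SymState.numV σ.nv σ
  set g := zgOf (GData.gaussEval K (GData.sanitize K (SymState.buildDataS K N σ.nv β A σ)))
  set m := popNS K (SymState.numA σ) A
  have hg := natAbs_gaussEval_le K (SymState.buildDataS K N σ.nv β A σ)
  have hc := natAbs_zgMul_iPowZg_le (m / 2) g
  have hc1 : (zgMul (iPowZg (m / 2)) g).1.natAbs ≤ 2 ^ K := hc.1.trans (max_le hg.1 hg.2)
  have hc2 : (zgMul (iPowZg (m / 2)) g).2.natAbs ≤ 2 ^ K := hc.2.trans (max_le hg.1 hg.2)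
  split
  · refine ⟨?_, ?_, h3.trans (Nat.le_add_right _ _), h4.trans (Nat.le_add_right _ _)⟩
    · exact (Int.natAbs_add_le _ _).trans (Nat.add_le_add h1 hc1)
    · exact (Int.natAbs_add_le _ _).trans (Nat.add_le_add h2 hc2)
  · refine ⟨h1.trans (Nat.le_add_right _ _), h2.trans (Nat.le_add_right _ _), ?_, ?_⟩
    · exact (Int.natAbs_add_le _ _).trans (Nat.add_le_add h3 hc1)
    · exact (Int.natAbs_add_le _ _).trans (Nat.add_le_add h4 hc2)

/-- `u ≤ 4M²`. [folklore] -/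
theorem natAbs_uZ_le {EO : (ℤ × ℤ) × (ℤ × ℤ)} {M : ℕ} (h : EOBound EO M) : (uZ EO).natAbs ≤ 4 * M ^ 2 := by
  obtain ⟨h1, h2, h3, h4⟩ := h
  unfold uZ
  have e : ∀ z : ℤ, z.natAbs ≤ M → (z ^ 2).natAbs ≤ M ^ 2 := fun z hz => by
    rw [Int.natAbs_pow]; exact Nat.pow_le_pow_left hz 2
  refine (Int.natAbs_add_le _ _).trans ?_
  refine (Nat.add_le_add ((Int.natAbs_add_le _ _).trans (Nat.add_le_add ((Int.natAbs_add_le _ _).trans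
    (Nat.add_le_add (e _ h1) (e _ h2))) (e _ h3))) (e _ h4)).trans ?_
  omega

/-- `|v| ≤ 4M²`. [folklore] -/
theorem natAbs_vZ_le {EO : (ℤ × ℤ) × (ℤ × ℤ)} {M : ℕ} (h : EOBound EO M) : (vZ EO).natAbs ≤ 4 * M ^ 2 := by
  obtain ⟨h1, h2, h3, h4⟩ := h
  unfold vZ
  have e : ∀ x y : ℤ, x.natAbs ≤ M → y.natAbs ≤ M → (x * y).natAbs ≤ M ^ 2 := fun x y hx hy => by
    rw [Int.natAbs_mul, pow_two]; exact Nat.mul_le_mul hx hy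
  refine (Int.natAbs_sub_le _ _).trans ?_
  refine (Nat.add_le_add ((Int.natAbs_add_le _ _).trans (Nat.add_le_add (e _ _ h1 h3) (e _ _ h2 h4)))
    ((Int.natAbs_sub_le _ _).trans (Nat.add_le_add (e _ _ h1 h4) (e _ _ h2 h3)))).trans ?_
  omega

/-- **The loop invariant**: term number below `2^{⌈t/2⌉}`, accumulators below `a 2ᴷ`, totals
below `l · 4 (2^{⌈t/2⌉} 2ᴷ)²` in absolute value. [folklore] -/
def InvLS (c : IT × List Bool) (s : LS) : Prop :=
  s.2.1 < numTerms c.1 ∧ EOBound s.2.2.1 (s.2.1 * 2 ^ SymState.numV (finalT c.1).nv (finalT c.1)) ∧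
    s.2.2.2.1.natAbs ≤ s.1 * (4 * (numTerms c.1 * 2 ^ SymState.numV (finalT c.1).nv (finalT c.1)) ^ 2) ∧
    s.2.2.2.2.natAbs ≤ s.1 * (4 * (numTerms c.1 * 2 ^ SymState.numV (finalT c.1).nv (finalT c.1)) ^ 2)

/-- The invariant holds initially. [folklore] -/
theorem invLS_initLS (c : IT × List Bool) : InvLS c initLS :=
  ⟨Nat.one_le_two_pow, ⟨by simp [initLS], by simp [initLS], by simp [initLS], by simp [initLS]⟩, by simp [initLS], by simp [initLS]⟩

/-- The invariant is kept by the step. [folklore] -/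
theorem InvLS.stepLS {c : IT × List Bool} {s : LS} (h : InvLS c s) : InvLS c (stepLS c s) := by
  obtain ⟨ha, hEO, hU, hV⟩ := h
  set K := SymState.numV (finalT c.1).nv (finalT c.1) with hK
  set A := numTerms c.1 with hA
  have hb := eoBound_termStepS (nWires c.1) (fun p => (blockOf c.1 c.2 s.1).getD p false) (finalT c.1) hEO s.2.1
  rw [← hK, show s.2.1 * 2 ^ K + 2 ^ K = (s.2.1 + 1) * 2 ^ K by ring] at hb
  have hb' : EOBound (termStepS (nWires c.1) (fun p => (blockOf c.1 c.2 s.1).getD p false) (finalT c.1) s.2.2.1 s.2.1)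
      (A * 2 ^ K) := by
    obtain ⟨b1, b2, b3, b4⟩ := hb
    have hm : (s.2.1 + 1) * 2 ^ K ≤ A * 2 ^ K := Nat.mul_le_mul_right _ ha
    exact ⟨b1.trans hm, b2.trans hm, b3.trans hm, b4.trans hm⟩
  unfold BravyiGosset.stepLS
  simp only
  split
  · rename_i hlt
    exact ⟨hlt, hb, hU, hV⟩
  · refine ⟨Nat.one_le_two_pow, ⟨by simp, by simp, by simp, by simp⟩, ?_, ?_⟩
    · refine (Int.natAbs_add_le _ _).trans ?_
      rw [Nat.succ_mul]
      exact Nat.add_le_add hU (natAbs_uZ_le hb')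
    · refine (Int.natAbs_add_le _ _).trans ?_
      rw [Nat.succ_mul]
      exact Nat.add_le_add hV (natAbs_vZ_le hb')

/-- The invariant along the orbit. [folklore] -/
theorem invLS_iterLS (c : IT × List Bool) (j : ℕ) : InvLS c (iterLS c j) := by
  induction j with
  | zero => exact invLS_initLS c
  | succ j ih => rw [iterLS, Function.iterate_succ_apply']; exact ih.stepLS

/-! ### The size of the loop state code -/

/-- The code of a natural below a power of two. [folklore] -/
theorem length_natE_le_of_lt {a m : ℕ} (h : a < 2 ^ m) : (natE a).length ≤ m := by
  rw [length_natE]; exact Nat.size_le.2 h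

/-- **The loop state code stays linear in `L + K`** (`K = numV`) along the first `L 2^{⌈t/2⌉}`
steps. [folklore] -/
theorem length_lsE_iterLS_le (c : IT × List Bool) {L j : ℕ} (hj : j ≤ L * numTerms c.1) :
    (lsE (iterLS c j)).length ≤ 150 * (L + SymState.numV (finalT c.1).nv (finalT c.1) + 1) := by
  obtain ⟨ha, hEO, hU, hV⟩ := invLS_iterLS c j
  set K := SymState.numV (finalT c.1).nv (finalT c.1) with hK
  set s := iterLS c j with hs
  have hA : numTerms c.1 = 2 ^ SymState.numA (finalT c.1) := rfl
  have hnumA : SymState.numA (finalT c.1) ≤ K := by rw [hK]; unfold SymState.numV; omega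
  have hl : s.1 ≤ L := by
    rw [hs, iterLS_fst]
    exact Nat.div_le_of_le_mul (by rw [Nat.mul_comm]; exact hj)
  -- powers of two
  have hL2 : L < 2 ^ L := Nat.lt_two_pow_self
  have hM : numTerms c.1 * 2 ^ K ≤ 2 ^ (2 * K) := by
    rw [hA, ← pow_add]; exact Nat.pow_le_pow_right (by norm_num) (by omega)
  have e1 : (natE s.1).length ≤ L := length_natE_le_of_lt (lt_of_le_of_lt hl hL2)
  have e2 : (natE s.2.1).length ≤ K := length_natE_le_of_lt (lt_of_lt_of_le ha (by rw [hA]; exact Nat.pow_le_pow_right (by norm_num) hnumA))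
  have hEOb : ∀ z : ℤ, z.natAbs ≤ s.2.1 * 2 ^ K → (intE z).length ≤ 3 * (2 * K) + 5 := fun z hz =>
    length_intE_le_of_natAbs_le (hz.trans ((Nat.mul_le_mul_right _ ha.le).trans hM))
  obtain ⟨b1, b2, b3, b4⟩ := hEO
  have e3 := hEOb _ b1
  have e4 := hEOb _ b2
  have e5 := hEOb _ b3
  have e6 := hEOb _ b4
  have hT : s.1 * (4 * (numTerms c.1 * 2 ^ K) ^ 2) ≤ 2 ^ (L + 2 + 4 * K) := by
    calc s.1 * (4 * (numTerms c.1 * 2 ^ K) ^ 2) ≤ 2 ^ L * (2 ^ 2 * (2 ^ (2 * K)) ^ 2) := by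
          refine Nat.mul_le_mul (hl.trans hL2.le) (Nat.mul_le_mul (by norm_num) (Nat.pow_le_pow_left hM 2))
      _ = 2 ^ (L + 2 + 4 * K) := by rw [← pow_mul, ← pow_add, ← pow_add]; ring_nf
  have e7 : (intE s.2.2.2.1).length ≤ 3 * (L + 2 + 4 * K) + 5 := length_intE_le_of_natAbs_le (hU.trans hT)
  have e8 : (intE s.2.2.2.2).length ≤ 3 * (L + 2 + 4 * K) + 5 := length_intE_le_of_natAbs_le (hV.trans hT)
  show (boolPair (natE s.1) (boolPair (natE s.2.1) (boolPair (boolPair (boolPair (intE s.2.2.1.1.1) (intE s.2.2.1.1.2))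
    (boolPair (intE s.2.2.1.2.1) (intE s.2.2.1.2.2))) (boolPair (intE s.2.2.2.1) (intE s.2.2.2.2))))).length ≤ _
  simp only [length_boolPair]
  omega

end Literature.Computability.QuantumComplexity.BravyiGosset
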